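import Summits.QuantumFields.YangMills.Theorems.BalabanUVNodesN15KingModelB9Thm31AllAtTrivialU
import Summits.QuantumFields.YangMills.Theorems.BalabanUVNodesN15KingModelFullPropagatorOperatorEntries
import Summits.QuantumFields.YangMills.Theorems.BalabanUVNodesN15VectorPieceBackground
import Literature.MathematicalPhysics.QuantumFieldTheory.Balaban1983to89.Beta.RemainderDecay190SectGBlocks

/-!
# BalabanUVNodes ∕ N15 — THE KING-MODEL RUNG, PART Σ-a: KING's FULL `A = 0` PROPAGATOR AS THE `U ≡ 1` LAYER OF THE BACKGROUND DEVICE —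
# THE NINE LETTERS n15-b's `ne2PlusOperator_background4` DISPLAYS, EACH A LANDED THEOREM OF THE RUNG READ IN `B11SectG.HasMaj (BlockNorm.ofBlocks …)` CURRENCY
# (Track A, DAG node N15 = NE2; FAN-OUT v1.1 §N15 s3 «KING-MODEL ∕ RIEMANN-KERNEL RUNG»; the joint -e∕-b knit, letters half)

HONEST FRAMING.  Count-neutral KNIT plumbing (cell `pub-ymgap`, seat `pub-ymgap-dag-n15-e` g11; `--supports stmt-QuantumFields-20544 --as helper` = K3⁷
`SpineGivenEndpointR13SepCoPH`).  No new estimate: every analytic input is a landed theorem of this rung (parts Ψ-e, P″, Q4a, Q4b); this file only READS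
them in the block-majorant currency of [B7] Sect. G ∕ [B6] (2.51) that n15-b's background device consumes.  TEMPLATE LITERATURE, `A = 0`: C. King's scalar
U(1)-Higgs MODEL on finite tori ([King1986] (2.13) p. 653, (4.1)–(4.5) p. 670), NOT Bałaban's covariant `G(U)`.  What is read: for King's FULL fluctuation
propagator `A₀⁻¹ = (fineOp (L^K) M a_K (L^K)² m²)⁻¹` ([Ba 4] (1.6) at `A = 0`) on the cube `2L^e` with `N = L^K` η-sites per unit block, King's pairing
`π = underPtN` to the run with `K + n` levels, and the unit blocks `blockOf` as [B6] sites of the one-scale unit-torus carrier (`B6UnitTorusCarrier.unitTorusGeo`,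
here dag-n15-a's sized copy `unitTorusGeoS` so that [B9]'s size parameter stays a datum):
* the five PLAIN letters `β·e^{−δ|y−y′|_T}` — `HasMaj` block majorants of `G = A₀⁻¹` and `S_ν = A₀⁻¹∘N∇*_ν` (coarse run) and of `G′`, `D′_μ = N′∇′_μ∘A₀′⁻¹`,
  `Δ′-entry = N′²Δ′∘A₀′⁻¹` (fine run) = part Ψ-e `fullPropOp∕DOp∕AdjOp∕LapOp_sup_decay` ([B9] (3.42)₀₋₃ at `U ≡ 1`, cube format);
* the four η-DEFECT letters `m₀·θ_K·e^{−δ|y−y′|_T}`, `θ_K = (L^K)^{−γ∕2}` — `HasMaj` majorants of `𝔇(G′,G) = G′∘τ − τ∘G` (`T4EtaRateDefect.idef` through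
  `pull π`), `𝔇(D′_μ,D_μ)`, `𝔇(S′_ν,S_ν)`, `𝔇(Δ′G′,ΔG)` = parts P″ `fullPropOp_rate_printed`, Q4a `fullPropDOp∕AdjOp_rate_printed`, Q4b `fullPropLapOp_rate_printed`
  (King's (3.71)∕(3.73) summed over (2.17), uniform in `n`);
* ★ `kingFullProp_uniform_layer`: all nine at ONE `(β, δ, m₀)`, for every `K ≥ 1`, `n ≥ 1`, cube `2L^e`, mass `0 < m² ≤ m₀²`, direction, size datum.
The sequel (part Σ-b `…KingModelFullPropagatorBgNE2`) plugs them into n15-b A4 `BackgroundLayer.ne2PlusOperator_background4` (as dag-n15-a part 27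
`…N15VectorPieceBackground` did for the single-scale vector piece): `T4EtaRate.NE2PlusOperator` BY NAME for King's full propagator DRESSED by a live
(3.35)-regular scalar background.  NE2⁺ is NOT PRINTED and not proved; NOT a node discharge; count-neutral; nothing continuum ∕ ℝ⁴ ∕ OS ∕ mass-gap ∕ Clay.
0 `sorry`, standard axioms; four plumbing `def`s (`kingGOp`, `kingDOp`, `kingSOp`, `kingLapOp`: the rung's operators as `LinearMap`s).  HONEST SCOPE: `A = 0`, periodic
b.c., odd `L ≥ 3`, cubes `2L^e`, `K, n ≥ 1`, `0 < m² ≤ m₀²`, `0 ≤ γ < 1`; King's spelling `(A₀⁻¹f)(x) = η^{d+1}Σ_yG(x,y)f(y)`; sharp block sup sizes; not Bałaban's `G(U)`;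
not a discharge.  WHAT THE CURVED CASE ADDS (one line): the same nine letters for `G(U)` over `Reg335` on the multiscale carrier — n15-b's device then dresses them.
Locators: [Balaban1985BackgroundPropagators] Thm 3.1 (3.42) p. 397, (3.35) p. 396, (3.63)–(3.65) pp. 402–403; [King1986] (2.13)–(2.17) p. 653, p. 664 (pairing),
Prop. 3.8 (3.71) p. 664, Prop. 3.9 (3.73) p. 665; [Balaban1984PropagatorsII] (2.51) p. 232 (block majorants); [Balaban1983RegularityDecay] (1.6) p. 572, (1.10) p. 573.
-/

noncomputable section

namespace Summit.QuantumFields.YangMills.BalabanUVNodes.N15KingModelRung.Curved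

open Real Finset Matrix
open Literature.MathematicalPhysics.QuantumFieldTheory.Balaban1983to89
open Literature.MathematicalPhysics.QuantumFieldTheory.Balaban1983to89.B11SectG (BlockNorm HasMaj)
open Literature.MathematicalPhysics.QuantumFieldTheory.Balaban1983to89.B6RandomWalk (BlockSupp)
open Literature.MathematicalPhysics.QuantumFieldTheory.Balaban1983to89.B6RandomWalkHom (HasMajorantHom)
open Literature.MathematicalPhysics.QuantumFieldTheory.Balaban1983to89.Beta.RemainderDecay190SectGBlocks (hasMaj_ofBlocks_of_hasMajorantHom)
open Literature.MathematicalPhysics.QuantumFieldTheory.Balaban1983to89.T4EtaRateDefect (idef idef_apply)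
open Literature.MathematicalPhysics.QuantumFieldTheory.Balaban1983to89.T4EtaRateCoeffDefect (pull pull_apply)
open Literature.MathematicalPhysics.QuantumFieldTheory.Balaban1983to89.B5Prop11Plancherel (Tor fine unitVec)
open Literature.MathematicalPhysics.QuantumFieldTheory.King1986 (aK)
open Literature.MathematicalPhysics.QuantumFieldTheory.King1986.Torus (fineOp blockOf tdistT tdistT_nonneg)
open Summit.QuantumFields.YangMills.BalabanUVNodes.N15.VectorPiece (unitTorusGeoS)

variable {d : ℕ} (L : ℕ)

/-! ## §0 The rung's four operators as linear maps -/

section Ops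

variable (a msq : ℝ) (K N : ℕ) [NeZero N] (M : Fin (d + 1) → ℕ) [∀ μ, NeZero (M μ)]

/-- `G = A₀⁻¹ = (fineOp N M a_K N² m²)⁻¹` as a linear map (King's (4.1)–(4.5) = [Ba 4] (1.6) at `A = 0`, inverted). [cite: King1986, (4.1)–(4.5) p.670; Balaban1983RegularityDecay, (1.6) p.572] -/
def kingGOp : (Tor (fine N M) → ℝ) →ₗ[ℝ] (Tor (fine N M) → ℝ) :=
  Matrix.mulVecLin (fineOp N M (aK a L K) (((N : ℕ) : ℝ) ^ 2) msq)⁻¹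

/-- `D_μ = N∇_μ ∘ A₀⁻¹` (the (3.42)₁ object: forward η-difference of `A₀⁻¹λ`, scaled by `N = η⁻¹`). [cite: Balaban1985BackgroundPropagators, (3.42) p.397 (second entry, shape)] -/
def kingDOp (μ : Fin (d + 1)) : (Tor (fine N M) → ℝ) →ₗ[ℝ] (Tor (fine N M) → ℝ) :=
  ((N : ℝ) • (pull (fun x : Tor (fine N M) => x + unitVec (fine N M) μ) - LinearMap.id)) ∘ₗ kingGOp L a msq K N M

/-- `S_ν = A₀⁻¹ ∘ N∇*_ν` (the (3.42)₂ object: `A₀⁻¹` of the scaled adjoint difference `N(λ(· − e_ν) − λ)`). [cite: Balaban1985BackgroundPropagators, (3.42) p.397 (third entry, shape)] -/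
def kingSOp (ν : Fin (d + 1)) : (Tor (fine N M) → ℝ) →ₗ[ℝ] (Tor (fine N M) → ℝ) :=
  kingGOp L a msq K N M ∘ₗ ((N : ℝ) • (pull (fun y : Tor (fine N M) => y - unitVec (fine N M) ν) - LinearMap.id))

/-- `N²Δ ∘ A₀⁻¹` (the (3.42)₃ object: the scaled lattice Laplacian of `A₀⁻¹λ`). [cite: Balaban1985BackgroundPropagators, (3.42) p.397 (fourth entry, shape)] -/
def kingLapOp : (Tor (fine N M) → ℝ) →ₗ[ℝ] (Tor (fine N M) → ℝ) :=
  ((((N : ℕ) : ℝ) ^ 2) • ∑ μ : Fin (d + 1), (pull (fun x : Tor (fine N M) => x + unitVec (fine N M) μ)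
      + pull (fun x : Tor (fine N M) => x - unitVec (fine N M) μ) - (2 : ℝ) • LinearMap.id)) ∘ₗ kingGOp L a msq K N M

/-- `(Gλ)(x) = (A₀⁻¹λ)(x)`. [folklore] -/
@[simp] theorem kingGOp_apply (lam : Tor (fine N M) → ℝ) (x : Tor (fine N M)) :
    kingGOp L a msq K N M lam x = ((fineOp N M (aK a L K) (((N : ℕ) : ℝ) ^ 2) msq)⁻¹ *ᵥ lam) x := rfl

/-- `(D_μλ)(x) = N((A₀⁻¹λ)(x + e_μ) − (A₀⁻¹λ)(x))`. [folklore] -/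
@[simp] theorem kingDOp_apply (μ : Fin (d + 1)) (lam : Tor (fine N M) → ℝ) (x : Tor (fine N M)) :
    kingDOp L a msq K N M μ lam x = (N : ℝ) * (((fineOp N M (aK a L K) (((N : ℕ) : ℝ) ^ 2) msq)⁻¹ *ᵥ lam) (x + unitVec (fine N M) μ)
      - ((fineOp N M (aK a L K) (((N : ℕ) : ℝ) ^ 2) msq)⁻¹ *ᵥ lam) x) := by
  simp [kingDOp, kingGOp]

/-- `(S_νλ)(x) = (A₀⁻¹(N(λ(· − e_ν) − λ)))(x)`. [folklore] -/
@[simp] theorem kingSOp_apply (ν : Fin (d + 1)) (lam : Tor (fine N M) → ℝ) (x : Tor (fine N M)) :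
    kingSOp L a msq K N M ν lam x
      = ((fineOp N M (aK a L K) (((N : ℕ) : ℝ) ^ 2) msq)⁻¹ *ᵥ (fun y => (N : ℝ) * (lam (y - unitVec (fine N M) ν) - lam y))) x := by
  simp only [kingSOp, kingGOp, LinearMap.coe_comp, Function.comp_apply, Matrix.mulVecLin_apply]
  congr 1

/-- `(N²ΔA₀⁻¹λ)(x) = N²Σ_μ[(A₀⁻¹λ)(x + e_μ) + (A₀⁻¹λ)(x − e_μ) − 2(A₀⁻¹λ)(x)]`. [folklore] -/
@[simp] theorem kingLapOp_apply (lam : Tor (fine N M) → ℝ) (x : Tor (fine N M)) :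
    kingLapOp L a msq K N M lam x = (((N : ℕ) : ℝ) ^ 2) *
      ∑ μ, (((fineOp N M (aK a L K) (((N : ℕ) : ℝ) ^ 2) msq)⁻¹ *ᵥ lam) (x + unitVec (fine N M) μ)
        + ((fineOp N M (aK a L K) (((N : ℕ) : ℝ) ^ 2) msq)⁻¹ *ᵥ lam) (x - unitVec (fine N M) μ)
        - 2 * ((fineOp N M (aK a L K) (((N : ℕ) : ℝ) ^ 2) msq)⁻¹ *ᵥ lam) x) := by
  simp only [kingLapOp, kingGOp, LinearMap.coe_comp, Function.comp_apply, LinearMap.smul_apply, LinearMap.sum_apply,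
    Finset.sum_apply, LinearMap.add_apply, LinearMap.sub_apply, pull_apply, LinearMap.id_coe, id_eq, Matrix.mulVecLin_apply,
    Pi.smul_apply, Pi.add_apply, Pi.sub_apply, smul_eq_mul]

end Ops

/-! ## §1 The dictionary: the rung's cube format IS a block majorant between the sharp block sizes -/

section Dictionary

variable {X₁ X₂ : Type} {M : Fin (d + 1) → ℕ} [∀ μ, NeZero (M μ)] {K : ℕ} {Msz : ℝ}

/-- THE CUBE FORMAT IS A TWO-LATTICE MAJORANT: if `|λ| ≤ F` and `D ≤ |B(x) − B(y)|_T` on `supp λ` force `|(Tλ)(x)| ≤ C·e^{−δD}·F` (natural `D` — the torus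
distance of unit blocks is a natural number), then `T` has the majorant `C·e^{−δ|y−y′|_T}` between the sharp block sizes ([B6] (2.51) format).
[cite: Balaban1984PropagatorsII, (2.51) p.232 («|(Tλ)(x)| ≤ K(y,y′)|λ|, x ∈ B(y), supp λ ⊂ B(y′)»)] -/
theorem hasMajorantHom_of_cubeBound (blk₁ : X₁ → Tor M) (blk₂ : X₂ → Tor M) (T : (X₁ → ℝ) →ₗ[ℝ] (X₂ → ℝ)) {C δ : ℝ}
    (h : ∀ (lam : X₁ → ℝ) (F : ℝ) (D : ℕ), (∀ y, |lam y| ≤ F) →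
      ∀ x, (∀ y, lam y ≠ 0 → (D : ℝ) ≤ tdistT M (blk₂ x) (blk₁ y)) → |T lam x| ≤ C * Real.exp (-(δ * D)) * F) :
    HasMajorantHom (g := unitTorusGeoS L K M Msz) blk₁ blk₂ T (fun y y' => C * Real.exp (-(δ * tdistT M y y'))) := by
  intro y' μ B hμ v
  obtain ⟨D, hD⟩ := exists_natCast_eq_tdistT M (blk₂ v) y'
  have hF : ∀ y, |μ y| ≤ B := fun y => by
    by_cases hy : blk₁ y = y'
    · exact hμ.bound y hy
    · rw [hμ.off y hy, abs_zero]; exact hμ.nonneg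
  have hsupp : ∀ y, μ y ≠ 0 → (D : ℝ) ≤ tdistT M (blk₂ v) (blk₁ y) := fun y hy => by
    have hb : blk₁ y = y' := by
      by_contra hne
      exact hy (hμ.off y hne)
    rw [hb, hD]
  have key := h μ B D hF v hsupp
  rw [← hD] at key
  exact key

/-- … hence a `HasMaj` between the sharp block sizes of the sized unit-torus carrier (`C ≥ 0`; [B7] Sect. G dictionary
`RemainderDecay190SectGBlocks.hasMaj_ofBlocks_of_hasMajorantHom`). [cite: Balaban1984PropagatorsII, (2.51) p.232; Balaban1985Variational, (189)–(190) p.308] -/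
theorem hasMaj_ofBlocks_of_cubeBound [Fintype X₁] [DecidableEq X₁] [Fintype X₂] (blk₁ : X₁ → Tor M) (blk₂ : X₂ → Tor M) (T : (X₁ → ℝ) →ₗ[ℝ] (X₂ → ℝ)) {C δ : ℝ} (hC : 0 ≤ C)
    (h : ∀ (lam : X₁ → ℝ) (F : ℝ) (D : ℕ), (∀ y, |lam y| ≤ F) →
      ∀ x, (∀ y, lam y ≠ 0 → (D : ℝ) ≤ tdistT M (blk₂ x) (blk₁ y)) → |T lam x| ≤ C * Real.exp (-(δ * D)) * F) :
    HasMaj (BlockNorm.ofBlocks (unitTorusGeoS L K M Msz) blk₁) (BlockNorm.ofBlocks (unitTorusGeoS L K M Msz) blk₂) T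
      (fun y y' => C * Real.exp (-(δ * tdistT M y y'))) :=
  hasMaj_ofBlocks_of_hasMajorantHom (g := unitTorusGeoS L K M Msz) blk₁ blk₂ (fun _ _ => mul_nonneg hC (Real.exp_nonneg _))
    (hasMajorantHom_of_cubeBound L blk₁ blk₂ T h)

end Dictionary

/-! ## §2 The five PLAIN letters: (3.42)₀₋₃ at `U ≡ 1` in block-majorant currency, coarse and fine runs -/

section Plain

variable [NeZero L]

/-- **PLAIN LETTERS `G`, `G′`**: `A₀⁻¹ ≤ β·e^{−δ|y−y′|_T}` between the sharp unit-block sizes, at every number of levels — in particular for the coarse run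
(`N = L^K`, blocks `blockOf`) and the fine run (`N′ = L^nL^K`, blocks `blockOf ∘ π`, `blockOf_underPtN`); part Ψ-e `fullPropOp_sup_decay` read through §1.
[cite: Balaban1985BackgroundPropagators, Thm 3.1 (3.42) p.397 (first entry); King1986, Thm 3.3 (3.7) p.656; Balaban1983RegularityDecay, Theorem (1.10) p.573] -/
theorem hasMaj_kingGOp (hLodd : Odd L) (hL : 2 ≤ L) {a : ℝ} (ha : 0 < a) {m0sq : ℝ} (hm0 : 0 ≤ m0sq) :
    ∃ β δ : ℝ, 0 < β ∧ 0 < δ ∧ ∀ (K : ℕ), 1 ≤ K → ∀ (n e : ℕ) (M : Fin (d + 1) → ℕ) [∀ μ, NeZero (M μ)], (∀ μ, M μ = 2 * L ^ e) →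
      ∀ (msq : ℝ), 0 < msq → msq ≤ m0sq → ∀ (Msz : ℝ),
      HasMaj (BlockNorm.ofBlocks (unitTorusGeoS L K M Msz) (blockOf (L ^ K) M)) (BlockNorm.ofBlocks (unitTorusGeoS L K M Msz) (blockOf (L ^ K) M))
          (kingGOp L a msq K (L ^ K) M) (fun y y' => β * Real.exp (-(δ * tdistT M y y')))
      ∧ HasMaj (BlockNorm.ofBlocks (unitTorusGeoS L K M Msz) (blockOf (L ^ K) M ∘ underPtN L K n M))
          (BlockNorm.ofBlocks (unitTorusGeoS L K M Msz) (blockOf (L ^ K) M ∘ underPtN L K n M))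
          (kingGOp L a msq (K + n) (L ^ n * L ^ K) M) (fun y y' => β * Real.exp (-(δ * tdistT M y y'))) := by
  obtain ⟨C, δ, hC, hδ, H⟩ := fullPropOp_sup_decay (d := d) L hLodd hL ha hm0
  refine ⟨C, δ, hC, hδ, fun K hK n e M _ hM msq hmsq hcap Msz => ⟨?_, ?_⟩⟩
  · refine hasMaj_ofBlocks_of_cubeBound L _ _ _ hC.le fun lam F D hF x hD => ?_
    exact H K hK (L ^ K) rfl e M hM msq hmsq hcap lam F D hF x hD
  · refine hasMaj_ofBlocks_of_cubeBound L _ _ _ hC.le fun lam F D hF x hD => ?_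
    have hD' : ∀ y, lam y ≠ 0 → (D : ℝ) ≤ tdistT M (blockOf (L ^ n * L ^ K) M x) (blockOf (L ^ n * L ^ K) M y) := fun y hy => by
      simpa only [Function.comp_apply, blockOf_underPtN] using hD y hy
    exact H (K + n) (by omega) (L ^ n * L ^ K) (by rw [pow_add, mul_comm]) e M hM msq hmsq hcap lam F D hF x hD'

/-- **PLAIN LETTER `D′_μ = N′∇′_μA₀′⁻¹`** (fine run): part Ψ-e `fullPropDOp_sup_decay` ([B9] (3.42)₁ at `U ≡ 1`) read through §1.
[cite: Balaban1985BackgroundPropagators, Thm 3.1 (3.42) p.397 (second entry); Balaban1983RegularityDecay, Theorem (1.10) p.573] -/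
theorem hasMaj_kingDOp (hLodd : Odd L) (hL : 2 ≤ L) {a : ℝ} (ha : 0 < a) {m0sq : ℝ} (hm0 : 0 ≤ m0sq) :
    ∃ β δ : ℝ, 0 < β ∧ 0 < δ ∧ ∀ (K : ℕ), 1 ≤ K → ∀ (n e : ℕ) (M : Fin (d + 1) → ℕ) [∀ μ, NeZero (M μ)], (∀ μ, M μ = 2 * L ^ e) →
      ∀ (msq : ℝ), 0 < msq → msq ≤ m0sq → ∀ (Msz : ℝ) (μ : Fin (d + 1)),
      HasMaj (BlockNorm.ofBlocks (unitTorusGeoS L K M Msz) (blockOf (L ^ K) M ∘ underPtN L K n M))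
          (BlockNorm.ofBlocks (unitTorusGeoS L K M Msz) (blockOf (L ^ K) M ∘ underPtN L K n M))
          (kingDOp L a msq (K + n) (L ^ n * L ^ K) M μ) (fun y y' => β * Real.exp (-(δ * tdistT M y y'))) := by
  obtain ⟨C, δ, hC, hδ, H⟩ := fullPropDOp_sup_decay (d := d) L hLodd hL ha hm0
  refine ⟨C, δ, hC, hδ, fun K hK n e M _ hM msq hmsq hcap Msz μ => ?_⟩
  · refine hasMaj_ofBlocks_of_cubeBound L _ _ _ hC.le fun lam F D hF x hD => ?_
    have hD' : ∀ y, lam y ≠ 0 → (D : ℝ) ≤ tdistT M (blockOf (L ^ n * L ^ K) M x) (blockOf (L ^ n * L ^ K) M y) := fun y hy => by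
      simpa only [Function.comp_apply, blockOf_underPtN] using hD y hy
    rw [kingDOp_apply]
    exact H (K + n) (by omega) (L ^ n * L ^ K) (by rw [pow_add, mul_comm]) e M hM msq hmsq hcap μ lam F D hF x hD'

/-- **PLAIN LETTER `S_ν = A₀⁻¹∘N∇*_ν`** (coarse run): part Ψ-e `fullPropAdjOp_sup_decay` ([B9] (3.42)₂ at `U ≡ 1`) read through §1.
[cite: Balaban1985BackgroundPropagators, Thm 3.1 (3.42) p.397 (third entry); King1986, Thm 3.3 (3.7) p.656] -/
theorem hasMaj_kingSOp (hLodd : Odd L) (hL : 2 ≤ L) {a : ℝ} (ha : 0 < a) {m0sq : ℝ} (hm0 : 0 ≤ m0sq) :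
    ∃ β δ : ℝ, 0 < β ∧ 0 < δ ∧ ∀ (K : ℕ), 1 ≤ K → ∀ (e : ℕ) (M : Fin (d + 1) → ℕ) [∀ μ, NeZero (M μ)], (∀ μ, M μ = 2 * L ^ e) →
      ∀ (msq : ℝ), 0 < msq → msq ≤ m0sq → ∀ (Msz : ℝ) (ν : Fin (d + 1)),
      HasMaj (BlockNorm.ofBlocks (unitTorusGeoS L K M Msz) (blockOf (L ^ K) M)) (BlockNorm.ofBlocks (unitTorusGeoS L K M Msz) (blockOf (L ^ K) M))
          (kingSOp L a msq K (L ^ K) M ν) (fun y y' => β * Real.exp (-(δ * tdistT M y y'))) := by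
  obtain ⟨C, δ, hC, hδ, H⟩ := fullPropAdjOp_sup_decay (d := d) L hLodd hL ha hm0
  refine ⟨C, δ, hC, hδ, fun K hK e M _ hM msq hmsq hcap Msz ν => ?_⟩
  · refine hasMaj_ofBlocks_of_cubeBound L _ _ _ hC.le fun lam F D hF x hD => ?_
    rw [kingSOp_apply]
    exact H K hK (L ^ K) rfl e M hM msq hmsq hcap ν lam F D hF x hD

/-- **PLAIN LETTER `N′²Δ′A₀′⁻¹`** (fine run): part Ψ-e `fullPropLapOp_sup_decay` ([B9] (3.42)₃ at `U ≡ 1`, via the equation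
`Δ^ηA₀⁻¹λ = m²A₀⁻¹λ + a_KQ*QA₀⁻¹λ − λ`) read through §1. [cite: Balaban1985BackgroundPropagators, Thm 3.1 (3.42) p.397 (fourth entry); King1986, (4.1)–(4.5) p.670] -/
theorem hasMaj_kingLapOp (hLodd : Odd L) (hL : 2 ≤ L) {a : ℝ} (ha : 0 < a) {m0sq : ℝ} (hm0 : 0 ≤ m0sq) :
    ∃ β δ : ℝ, 0 < β ∧ 0 < δ ∧ ∀ (K : ℕ), 1 ≤ K → ∀ (n e : ℕ) (M : Fin (d + 1) → ℕ) [∀ μ, NeZero (M μ)], (∀ μ, M μ = 2 * L ^ e) →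
      ∀ (msq : ℝ), 0 < msq → msq ≤ m0sq → ∀ (Msz : ℝ),
      HasMaj (BlockNorm.ofBlocks (unitTorusGeoS L K M Msz) (blockOf (L ^ K) M ∘ underPtN L K n M))
          (BlockNorm.ofBlocks (unitTorusGeoS L K M Msz) (blockOf (L ^ K) M ∘ underPtN L K n M))
          (kingLapOp L a msq (K + n) (L ^ n * L ^ K) M) (fun y y' => β * Real.exp (-(δ * tdistT M y y'))) := by
  obtain ⟨C, δ, hC, hδ, H⟩ := fullPropLapOp_sup_decay (d := d) L hLodd hL ha hm0
  refine ⟨C, δ, hC, hδ, fun K hK n e M _ hM msq hmsq hcap Msz => ?_⟩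
  · refine hasMaj_ofBlocks_of_cubeBound L _ _ _ hC.le fun lam F D hF x hD => ?_
    have hD' : ∀ y, lam y ≠ 0 → (D : ℝ) ≤ tdistT M (blockOf (L ^ n * L ^ K) M x) (blockOf (L ^ n * L ^ K) M y) := fun y hy => by
      simpa only [Function.comp_apply, blockOf_underPtN] using hD y hy
    rw [kingLapOp_apply]
    exact H (K + n) (by omega) (L ^ n * L ^ K) (by rw [pow_add, mul_comm]) e M hM msq hmsq hcap lam F D hF x hD'

end Plain

/-! ## §3 The four η-DEFECT letters: King's (3.71)∕(3.73) summed over (2.17), in block-majorant currency through `idef (pull π) (pull π)` -/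

section Defect

/-- `(L^{−γ∕2})^K = (L^K)^{−γ∕2}` — the rung's rate factor IS the device's rate number `rateWeight (unitTorusGeoS L K M Msz) (γ∕2)`. [folklore] -/
theorem theta_pow_eq_pow_rpow (K : ℕ) (γ : ℝ) : ((L : ℝ) ^ (-(γ / 2))) ^ K = ((L : ℝ) ^ K) ^ (-(γ / 2)) := by
  have hL : (0 : ℝ) ≤ (L : ℝ) := Nat.cast_nonneg L
  rw [← Real.rpow_natCast ((L : ℝ) ^ (-(γ / 2))) K, ← Real.rpow_mul hL, mul_comm, Real.rpow_mul hL, Real.rpow_natCast]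

variable [NeZero L]

/-- **DEFECT LETTER `𝔇(G′, G)`**: `G′∘τ − τ∘G ≤ m₀·(L^K)^{−γ∕2}·e^{−δ|y−y′|_T}` from the sharp unit-block size of the coarse run to that of the fine run
(`τλ = λ∘π`, King's pairing) — part P″ `fullPropOp_rate_printed` (King's (3.71) with `a = 0` summed over (2.17), uniform in `n`) read through §1.
[cite: King1986, Prop. 3.8 (3.71) p.664, p.664 (pairing); Balaban1985BackgroundPropagators, Thm 3.1 (3.42) p.397 (first entry, shape)] -/
theorem hasMaj_idef_kingGOp (hLodd : Odd L) (hL : 2 ≤ L) {a : ℝ} (ha : 0 < a) {m0sq : ℝ} (hm0 : 0 ≤ m0sq) {γ : ℝ} (hγ0 : 0 ≤ γ) (hγ1 : γ < 1) :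
    ∃ m₀ δ : ℝ, 0 < m₀ ∧ 0 < δ ∧ ∀ (K : ℕ), 1 ≤ K → ∀ (n : ℕ), 1 ≤ n → ∀ (e : ℕ) (M : Fin (d + 1) → ℕ) [∀ μ, NeZero (M μ)], (∀ μ, M μ = 2 * L ^ e) →
      ∀ (msq : ℝ), 0 < msq → msq ≤ m0sq → ∀ (Msz : ℝ),
      HasMaj (BlockNorm.ofBlocks (unitTorusGeoS L K M Msz) (blockOf (L ^ K) M))
        (BlockNorm.ofBlocks (unitTorusGeoS L K M Msz) (blockOf (L ^ K) M ∘ underPtN L K n M))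
        (idef (pull (underPtN L K n M)) (pull (underPtN L K n M)) (kingGOp L a msq (K + n) (L ^ n * L ^ K) M) (kingGOp L a msq K (L ^ K) M))
        (fun y y' => m₀ * ((L : ℝ) ^ K) ^ (-(γ / 2)) * Real.exp (-(δ * tdistT M y y'))) := by
  obtain ⟨C, δ, hC, hδ, H⟩ := fullPropOp_rate_printed (d := d) L hLodd hL ha hm0 hγ0 hγ1.le
  refine ⟨C, δ, hC, hδ, fun K hK n hn e M _ hM msq hmsq hcap Msz => ?_⟩
  have hθ : 0 ≤ C * ((L : ℝ) ^ K) ^ (-(γ / 2)) := mul_nonneg hC.le (Real.rpow_nonneg (pow_nonneg (Nat.cast_nonneg _) _) _)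
  refine hasMaj_ofBlocks_of_cubeBound L _ _ _ hθ fun lam F D hF x' hD => ?_
  rw [idef_apply, Pi.sub_apply, pull_apply, kingGOp_apply, kingGOp_apply, ← theta_pow_eq_pow_rpow]
  exact H K hK n hn e M hM msq hmsq hcap lam F hF D x' hD

/-- **DEFECT LETTER `𝔇(D′_μ, D_μ)`** (the scaled forward differences): part Q4a `fullPropDOp_rate_printed` (King's (3.73) `|a| = 1, b = 0` summed) read through §1.
[cite: King1986, Prop. 3.9 (3.73) p.665; Balaban1985BackgroundPropagators, Thm 3.1 (3.42) p.397 (second entry, shape)] -/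
theorem hasMaj_idef_kingDOp (hLodd : Odd L) (hL : 2 ≤ L) {a : ℝ} (ha : 0 < a) {m0sq : ℝ} (hm0 : 0 ≤ m0sq) {γ : ℝ} (hγ0 : 0 ≤ γ) (hγ1 : γ < 1) :
    ∃ m₀ δ : ℝ, 0 < m₀ ∧ 0 < δ ∧ ∀ (K : ℕ), 1 ≤ K → ∀ (n : ℕ), 1 ≤ n → ∀ (e : ℕ) (M : Fin (d + 1) → ℕ) [∀ μ, NeZero (M μ)], (∀ μ, M μ = 2 * L ^ e) →
      ∀ (msq : ℝ), 0 < msq → msq ≤ m0sq → ∀ (Msz : ℝ) (μ : Fin (d + 1)),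
      HasMaj (BlockNorm.ofBlocks (unitTorusGeoS L K M Msz) (blockOf (L ^ K) M))
        (BlockNorm.ofBlocks (unitTorusGeoS L K M Msz) (blockOf (L ^ K) M ∘ underPtN L K n M))
        (idef (pull (underPtN L K n M)) (pull (underPtN L K n M)) (kingDOp L a msq (K + n) (L ^ n * L ^ K) M μ) (kingDOp L a msq K (L ^ K) M μ))
        (fun y y' => m₀ * ((L : ℝ) ^ K) ^ (-(γ / 2)) * Real.exp (-(δ * tdistT M y y'))) := by
  obtain ⟨C, δ, hC, hδ, H⟩ := fullPropDOp_rate_printed (d := d) L hLodd hL ha hm0 hγ0 hγ1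
  refine ⟨C, δ, hC, hδ, fun K hK n hn e M _ hM msq hmsq hcap Msz μ => ?_⟩
  have hθ : 0 ≤ C * ((L : ℝ) ^ K) ^ (-(γ / 2)) := mul_nonneg hC.le (Real.rpow_nonneg (pow_nonneg (Nat.cast_nonneg _) _) _)
  refine hasMaj_ofBlocks_of_cubeBound L _ _ _ hθ fun lam F D hF x' hD => ?_
  rw [idef_apply, Pi.sub_apply, pull_apply, kingDOp_apply, kingDOp_apply, ← theta_pow_eq_pow_rpow]
  exact H K hK n hn e M hM msq hmsq hcap μ lam F hF D x' hD

/-- **DEFECT LETTER `𝔇(S′_ν, S_ν)`** (the source steps `A₀⁻¹∘N∇*_ν`): part Q4a `fullPropAdjOp_rate_printed` (King's (3.73) `a = 0, |b| = 1` summed) read through §1.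
[cite: King1986, Prop. 3.9 (3.73) p.665; Balaban1985BackgroundPropagators, Thm 3.1 (3.42) p.397 (third entry, shape)] -/
theorem hasMaj_idef_kingSOp (hLodd : Odd L) (hL : 2 ≤ L) {a : ℝ} (ha : 0 < a) {m0sq : ℝ} (hm0 : 0 ≤ m0sq) {γ : ℝ} (hγ0 : 0 ≤ γ) (hγ1 : γ < 1) :
    ∃ m₀ δ : ℝ, 0 < m₀ ∧ 0 < δ ∧ ∀ (K : ℕ), 1 ≤ K → ∀ (n : ℕ), 1 ≤ n → ∀ (e : ℕ) (M : Fin (d + 1) → ℕ) [∀ μ, NeZero (M μ)], (∀ μ, M μ = 2 * L ^ e) →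
      ∀ (msq : ℝ), 0 < msq → msq ≤ m0sq → ∀ (Msz : ℝ) (ν : Fin (d + 1)),
      HasMaj (BlockNorm.ofBlocks (unitTorusGeoS L K M Msz) (blockOf (L ^ K) M))
        (BlockNorm.ofBlocks (unitTorusGeoS L K M Msz) (blockOf (L ^ K) M ∘ underPtN L K n M))
        (idef (pull (underPtN L K n M)) (pull (underPtN L K n M)) (kingSOp L a msq (K + n) (L ^ n * L ^ K) M ν) (kingSOp L a msq K (L ^ K) M ν))
        (fun y y' => m₀ * ((L : ℝ) ^ K) ^ (-(γ / 2)) * Real.exp (-(δ * tdistT M y y'))) := by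
  obtain ⟨C, δ, hC, hδ, H⟩ := fullPropAdjOp_rate_printed (d := d) L hLodd hL ha hm0 hγ0 hγ1
  refine ⟨C, δ, hC, hδ, fun K hK n hn e M _ hM msq hmsq hcap Msz ν => ?_⟩
  have hθ : 0 ≤ C * ((L : ℝ) ^ K) ^ (-(γ / 2)) := mul_nonneg hC.le (Real.rpow_nonneg (pow_nonneg (Nat.cast_nonneg _) _) _)
  refine hasMaj_ofBlocks_of_cubeBound L _ _ _ hθ fun lam F D hF x' hD => ?_
  rw [idef_apply, Pi.sub_apply, pull_apply, kingSOp_apply, kingSOp_apply, ← theta_pow_eq_pow_rpow]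
  simp only [pull_apply]
  exact H K hK n hn e M hM msq hmsq hcap ν lam F hF D x' hD

/-- **DEFECT LETTER `𝔇(N′²Δ′A₀′⁻¹, N²ΔA₀⁻¹)`** (the Laplacian entries): part Q4b `fullPropLapOp_rate_printed` (through the equation `Δ^ηA₀⁻¹ = m²A₀⁻¹ + a_KQ*QA₀⁻¹ − 1`
and the operator-layer rates, (2.17)-summed) read through §1. [cite: King1986, (2.17) p.653, Prop. 3.8 (3.71) p.664; Balaban1985BackgroundPropagators, Thm 3.1 (3.42) p.397 (fourth entry, shape)] -/
theorem hasMaj_idef_kingLapOp (hLodd : Odd L) (hL : 2 ≤ L) {a : ℝ} (ha : 0 < a) {m0sq : ℝ} (hm0 : 0 ≤ m0sq) {γ : ℝ} (hγ0 : 0 ≤ γ) (hγ1 : γ < 1) :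
    ∃ m₀ δ : ℝ, 0 < m₀ ∧ 0 < δ ∧ ∀ (K : ℕ), 1 ≤ K → ∀ (n : ℕ), 1 ≤ n → ∀ (e : ℕ) (M : Fin (d + 1) → ℕ) [∀ μ, NeZero (M μ)], (∀ μ, M μ = 2 * L ^ e) →
      ∀ (msq : ℝ), 0 < msq → msq ≤ m0sq → ∀ (Msz : ℝ),
      HasMaj (BlockNorm.ofBlocks (unitTorusGeoS L K M Msz) (blockOf (L ^ K) M))
        (BlockNorm.ofBlocks (unitTorusGeoS L K M Msz) (blockOf (L ^ K) M ∘ underPtN L K n M))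
        (idef (pull (underPtN L K n M)) (pull (underPtN L K n M)) (kingLapOp L a msq (K + n) (L ^ n * L ^ K) M) (kingLapOp L a msq K (L ^ K) M))
        (fun y y' => m₀ * ((L : ℝ) ^ K) ^ (-(γ / 2)) * Real.exp (-(δ * tdistT M y y'))) := by
  obtain ⟨C, δ, hC, hδ, H⟩ := fullPropLapOp_rate_printed (d := d) L hLodd hL ha hm0 hγ0 hγ1.le
  refine ⟨C, δ, hC, hδ, fun K hK n hn e M _ hM msq hmsq hcap Msz => ?_⟩
  have hθ : 0 ≤ C * ((L : ℝ) ^ K) ^ (-(γ / 2)) := mul_nonneg hC.le (Real.rpow_nonneg (pow_nonneg (Nat.cast_nonneg _) _) _)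
  refine hasMaj_ofBlocks_of_cubeBound L _ _ _ hθ fun lam F D hF x' hD => ?_
  rw [idef_apply, Pi.sub_apply, pull_apply, kingLapOp_apply, kingLapOp_apply, ← theta_pow_eq_pow_rpow]
  exact H K hK n hn e M hM msq hmsq hcap lam F hF D x' hD

end Defect

/-! ## §4 The whole `U ≡ 1` layer at ONE `(β, δ, m₀)` -/

section Layer

variable [NeZero L] {M : Fin (d + 1) → ℕ} [∀ μ, NeZero (M μ)]

omit [NeZero L] in
/-- Weakening a decaying majorant: larger constant, slower rate (`d ≥ 0`). [folklore] -/
theorem hasMaj_exp_weaken {K : ℕ} {Msz : ℝ} {X₁ X₂ : Type} [Fintype X₁] [Fintype X₂] {blk₁ : X₁ → Tor M} {blk₂ : X₂ → Tor M}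
    {T : (X₁ → ℝ) →ₗ[ℝ] (X₂ → ℝ)} {C C' δ δ' : ℝ} (hC : 0 ≤ C) (hCC : C ≤ C') (hδδ : δ' ≤ δ)
    (h : HasMaj (BlockNorm.ofBlocks (unitTorusGeoS L K M Msz) blk₁) (BlockNorm.ofBlocks (unitTorusGeoS L K M Msz) blk₂) T
      (fun y y' => C * Real.exp (-(δ * tdistT M y y')))) :
    HasMaj (BlockNorm.ofBlocks (unitTorusGeoS L K M Msz) blk₁) (BlockNorm.ofBlocks (unitTorusGeoS L K M Msz) blk₂) T
      (fun y y' => C' * Real.exp (-(δ' * tdistT M y y'))) :=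
  h.mono fun y y' => mul_le_mul hCC (Real.exp_le_exp.mpr (neg_le_neg (mul_le_mul_of_nonneg_right hδδ (tdistT_nonneg M y y'))))
    (Real.exp_nonneg _) (hC.trans hCC)

/-- ★ **THE UNIFORM `U ≡ 1` LAYER OF KING's FULL `A = 0` PROPAGATOR** — the nine letters n15-b's `BackgroundLayer.ne2PlusOperator_background4` displays, at ONE
`(β, δ, m₀)`: for odd `L ≥ 3`, `a > 0`, `m₀² ≥ 0`, `0 ≤ γ < 1` there are `β, δ, m₀ > 0` such that for every `K ≥ 1`, `n ≥ 1`, cube `2L^e`, mass `0 < m² ≤ m₀²`,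
size datum `Msz` and direction `μ`: the five PLAIN block majorants `β·e^{−δ|y−y′|_T}` of `G = A₀⁻¹` (coarse), `G′` (fine), `S_μ = A₀⁻¹∘N∇*_μ` (coarse),
`D′_μ = N′∇′_μA₀′⁻¹`, `N′²Δ′A₀′⁻¹` (fine), and the four η-DEFECT majorants `m₀·(L^K)^{−γ∕2}·e^{−δ|y−y′|_T}` of `(G′,G)`, `(D′_μ,D_μ)`, `(S′_μ,S_μ)`,
`(N′²Δ′A₀′⁻¹, N²ΔA₀⁻¹)` through King's pairing — (3.42)₀₋₃ at `U ≡ 1` and their η-rates for the FULL multi-level propagator, uniformly.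
[cite: Balaban1985BackgroundPropagators, Thm 3.1 (3.42) p.397 (shape); King1986, (2.13)–(2.17) p.653, Prop. 3.8 (3.71) p.664, Prop. 3.9 (3.73) p.665; Balaban1983RegularityDecay, Theorem (1.10) p.573] -/
theorem kingFullProp_uniform_layer (hLodd : Odd L) (hL : 2 ≤ L) {a : ℝ} (ha : 0 < a) {m0sq : ℝ} (hm0 : 0 ≤ m0sq) {γ : ℝ} (hγ0 : 0 ≤ γ) (hγ1 : γ < 1) :
    ∃ β δ m₀ : ℝ, 0 < β ∧ 0 < δ ∧ 0 < m₀ ∧ ∀ (K : ℕ), 1 ≤ K → ∀ (n : ℕ), 1 ≤ n → ∀ (e : ℕ) (M : Fin (d + 1) → ℕ) [∀ μ, NeZero (M μ)],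
      (∀ μ, M μ = 2 * L ^ e) → ∀ (msq : ℝ), 0 < msq → msq ≤ m0sq → ∀ (Msz : ℝ) (μ : Fin (d + 1)),
      HasMaj (BlockNorm.ofBlocks (unitTorusGeoS L K M Msz) (blockOf (L ^ K) M)) (BlockNorm.ofBlocks (unitTorusGeoS L K M Msz) (blockOf (L ^ K) M))
          (kingGOp L a msq K (L ^ K) M) (fun y y' => β * Real.exp (-(δ * tdistT M y y')))
      ∧ HasMaj (BlockNorm.ofBlocks (unitTorusGeoS L K M Msz) (blockOf (L ^ K) M ∘ underPtN L K n M))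
          (BlockNorm.ofBlocks (unitTorusGeoS L K M Msz) (blockOf (L ^ K) M ∘ underPtN L K n M))
          (kingGOp L a msq (K + n) (L ^ n * L ^ K) M) (fun y y' => β * Real.exp (-(δ * tdistT M y y')))
      ∧ HasMaj (BlockNorm.ofBlocks (unitTorusGeoS L K M Msz) (blockOf (L ^ K) M)) (BlockNorm.ofBlocks (unitTorusGeoS L K M Msz) (blockOf (L ^ K) M))
          (kingSOp L a msq K (L ^ K) M μ) (fun y y' => β * Real.exp (-(δ * tdistT M y y')))
      ∧ HasMaj (BlockNorm.ofBlocks (unitTorusGeoS L K M Msz) (blockOf (L ^ K) M ∘ underPtN L K n M))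
          (BlockNorm.ofBlocks (unitTorusGeoS L K M Msz) (blockOf (L ^ K) M ∘ underPtN L K n M))
          (kingDOp L a msq (K + n) (L ^ n * L ^ K) M μ) (fun y y' => β * Real.exp (-(δ * tdistT M y y')))
      ∧ HasMaj (BlockNorm.ofBlocks (unitTorusGeoS L K M Msz) (blockOf (L ^ K) M ∘ underPtN L K n M))
          (BlockNorm.ofBlocks (unitTorusGeoS L K M Msz) (blockOf (L ^ K) M ∘ underPtN L K n M))
          (kingLapOp L a msq (K + n) (L ^ n * L ^ K) M) (fun y y' => β * Real.exp (-(δ * tdistT M y y')))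
      ∧ HasMaj (BlockNorm.ofBlocks (unitTorusGeoS L K M Msz) (blockOf (L ^ K) M))
          (BlockNorm.ofBlocks (unitTorusGeoS L K M Msz) (blockOf (L ^ K) M ∘ underPtN L K n M))
          (idef (pull (underPtN L K n M)) (pull (underPtN L K n M)) (kingGOp L a msq (K + n) (L ^ n * L ^ K) M) (kingGOp L a msq K (L ^ K) M))
          (fun y y' => m₀ * ((L : ℝ) ^ K) ^ (-(γ / 2)) * Real.exp (-(δ * tdistT M y y')))
      ∧ HasMaj (BlockNorm.ofBlocks (unitTorusGeoS L K M Msz) (blockOf (L ^ K) M))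
          (BlockNorm.ofBlocks (unitTorusGeoS L K M Msz) (blockOf (L ^ K) M ∘ underPtN L K n M))
          (idef (pull (underPtN L K n M)) (pull (underPtN L K n M)) (kingDOp L a msq (K + n) (L ^ n * L ^ K) M μ) (kingDOp L a msq K (L ^ K) M μ))
          (fun y y' => m₀ * ((L : ℝ) ^ K) ^ (-(γ / 2)) * Real.exp (-(δ * tdistT M y y')))
      ∧ HasMaj (BlockNorm.ofBlocks (unitTorusGeoS L K M Msz) (blockOf (L ^ K) M))
          (BlockNorm.ofBlocks (unitTorusGeoS L K M Msz) (blockOf (L ^ K) M ∘ underPtN L K n M))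
          (idef (pull (underPtN L K n M)) (pull (underPtN L K n M)) (kingSOp L a msq (K + n) (L ^ n * L ^ K) M μ) (kingSOp L a msq K (L ^ K) M μ))
          (fun y y' => m₀ * ((L : ℝ) ^ K) ^ (-(γ / 2)) * Real.exp (-(δ * tdistT M y y')))
      ∧ HasMaj (BlockNorm.ofBlocks (unitTorusGeoS L K M Msz) (blockOf (L ^ K) M))
          (BlockNorm.ofBlocks (unitTorusGeoS L K M Msz) (blockOf (L ^ K) M ∘ underPtN L K n M))
          (idef (pull (underPtN L K n M)) (pull (underPtN L K n M)) (kingLapOp L a msq (K + n) (L ^ n * L ^ K) M) (kingLapOp L a msq K (L ^ K) M))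
          (fun y y' => m₀ * ((L : ℝ) ^ K) ^ (-(γ / 2)) * Real.exp (-(δ * tdistT M y y'))) := by
  obtain ⟨β₀, δ₀, hβ₀, hδ₀, H0⟩ := hasMaj_kingGOp (d := d) L hLodd hL ha hm0
  obtain ⟨β₁, δ₁, hβ₁, hδ₁, H1⟩ := hasMaj_kingDOp (d := d) L hLodd hL ha hm0
  obtain ⟨β₂, δ₂, hβ₂, hδ₂, H2⟩ := hasMaj_kingSOp (d := d) L hLodd hL ha hm0
  obtain ⟨β₃, δ₃, hβ₃, hδ₃, H3⟩ := hasMaj_kingLapOp (d := d) L hLodd hL ha hm0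
  obtain ⟨m₀', ρ₀, hm₀', hρ₀, D0⟩ := hasMaj_idef_kingGOp (d := d) L hLodd hL ha hm0 hγ0 hγ1
  obtain ⟨m₁, ρ₁, hm₁, hρ₁, D1⟩ := hasMaj_idef_kingDOp (d := d) L hLodd hL ha hm0 hγ0 hγ1
  obtain ⟨m₂, ρ₂, hm₂, hρ₂, D2⟩ := hasMaj_idef_kingSOp (d := d) L hLodd hL ha hm0 hγ0 hγ1
  obtain ⟨m₃, ρ₃, hm₃, hρ₃, D3⟩ := hasMaj_idef_kingLapOp (d := d) L hLodd hL ha hm0 hγ0 hγ1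
  -- one constant, one rate
  set β : ℝ := max (max β₀ β₁) (max β₂ β₃) with hβ
  set m₀ : ℝ := max (max m₀' m₁) (max m₂ m₃) with hm₀
  set δ : ℝ := min (min (min δ₀ δ₁) (min δ₂ δ₃)) (min (min ρ₀ ρ₁) (min ρ₂ ρ₃)) with hδ
  have hβpos : 0 < β := lt_max_of_lt_left (lt_max_of_lt_left hβ₀)
  have hm₀pos : 0 < m₀ := lt_max_of_lt_left (lt_max_of_lt_left hm₀')
  have hδpos : 0 < δ := lt_min (lt_min (lt_min hδ₀ hδ₁) (lt_min hδ₂ hδ₃)) (lt_min (lt_min hρ₀ hρ₁) (lt_min hρ₂ hρ₃))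
  obtain ⟨hb₀, hb₁, hb₂, hb₃⟩ : β₀ ≤ β ∧ β₁ ≤ β ∧ β₂ ≤ β ∧ β₃ ≤ β := by simp only [hβ, le_max_iff, le_refl, true_or, or_true, and_self]
  obtain ⟨hn₀, hn₁, hn₂, hn₃⟩ : m₀' ≤ m₀ ∧ m₁ ≤ m₀ ∧ m₂ ≤ m₀ ∧ m₃ ≤ m₀ := by simp only [hm₀, le_max_iff, le_refl, true_or, or_true, and_self]
  obtain ⟨hd₀, hd₁, hd₂, hd₃, hr₀, hr₁, hr₂, hr₃⟩ : δ ≤ δ₀ ∧ δ ≤ δ₁ ∧ δ ≤ δ₂ ∧ δ ≤ δ₃ ∧ δ ≤ ρ₀ ∧ δ ≤ ρ₁ ∧ δ ≤ ρ₂ ∧ δ ≤ ρ₃ := by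
    simp only [hδ, min_le_iff, le_refl, true_or, or_true, and_self]
  refine ⟨β, δ, m₀, hβpos, hδpos, hm₀pos, fun K hK n hn e M _ hM msq hmsq hcap Msz μ => ?_⟩
  have hθ : 0 ≤ ((L : ℝ) ^ K) ^ (-(γ / 2)) := Real.rpow_nonneg (pow_nonneg (Nat.cast_nonneg _) _) _
  -- the rate-number versions of the weakening
  have hw : ∀ {m m' : ℝ}, 0 ≤ m → m ≤ m' → 0 ≤ m * ((L : ℝ) ^ K) ^ (-(γ / 2)) ∧ m * ((L : ℝ) ^ K) ^ (-(γ / 2)) ≤ m' * ((L : ℝ) ^ K) ^ (-(γ / 2)) :=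
    fun hm hmm => ⟨mul_nonneg hm hθ, mul_le_mul_of_nonneg_right hmm hθ⟩
  obtain ⟨hG, hG'⟩ := H0 K hK n e M hM msq hmsq hcap Msz
  have hD' := H1 K hK n e M hM msq hmsq hcap Msz μ
  have hS := H2 K hK e M hM msq hmsq hcap Msz μ
  have hLap' := H3 K hK n e M hM msq hmsq hcap Msz
  refine ⟨hasMaj_exp_weaken L hβ₀.le hb₀ hd₀ hG, hasMaj_exp_weaken L hβ₀.le hb₀ hd₀ hG', hasMaj_exp_weaken L hβ₂.le hb₂ hd₂ hS,
    hasMaj_exp_weaken L hβ₁.le hb₁ hd₁ hD', hasMaj_exp_weaken L hβ₃.le hb₃ hd₃ hLap', ?_, ?_, ?_, ?_⟩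
  · exact hasMaj_exp_weaken L (hw hm₀'.le hn₀).1 (hw hm₀'.le hn₀).2 hr₀ (D0 K hK n hn e M hM msq hmsq hcap Msz)
  · exact hasMaj_exp_weaken L (hw hm₁.le hn₁).1 (hw hm₁.le hn₁).2 hr₁ (D1 K hK n hn e M hM msq hmsq hcap Msz μ)
  · exact hasMaj_exp_weaken L (hw hm₂.le hn₂).1 (hw hm₂.le hn₂).2 hr₂ (D2 K hK n hn e M hM msq hmsq hcap Msz μ)
  · exact hasMaj_exp_weaken L (hw hm₃.le hn₃).1 (hw hm₃.le hn₃).2 hr₃ (D3 K hK n hn e M hM msq hmsq hcap Msz)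

end Layer

end Summit.QuantumFields.YangMills.BalabanUVNodes.N15KingModelRung.Curved

end
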